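import Summits.QuantumFields.YangMills.Theorems.ColdStartUniversalityLatticeLangevinLiebRobinsonLocalMixing
import Summits.QuantumFields.YangMills.Theorems.ColdStartUniversalityLatticeLangevinLoopAverageCarre
import HarnessLib

/-!
# Route `ColdStartUniversality` (fixed-cut-off SZZ dynamics; LIEB–ROBINSON / LOCALITY package, file 8):
# ★★★ A FIXED WILSON LOOP EQUILIBRATES FROM EVERY START WITH VOLUME-FREE CONSTANTS at `|β'| < 1/12`

Helper file (seat `ym-line-csu-p1`, g30; `--supports stmt-QuantumFields-24809`).  The concrete instance of `wilson_local_pointwise_mixing_uniform`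
for the basic local observables of lattice gauge theory: the real trace of a WORD `w = a₁⋯a_n` of link matrices and their adjoints (a Wilson loop
at a FIXED position, a plaquette, any product of links — no translation average):
* `contDiff_word` — `y ↦ Re tr w(rebuild y)` is smooth; `word_coords_local` — it depends only on the links occurring in `w`;
* `sum_countP_edge_eq_length` — `Σ_e #{k : edge(a_k) = e} = |w|`;
* ★★ `wilson_word_carre_le` — `Γ^A(Re tr w) ≤ 32·|w|²` on `SU(2)^E` (word calculus `word_frameDeriv_abs_le`: `|W_(e,ν) Re tr w| ≤ 2·m_e(w)`);
* ★★★ `wilson_word_pointwise_mixing_uniform` / `wilson_solution_word_pointwise_mixing_uniform` — at `|β'| < 1/12`, for every `L`, every word `w`,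
  every lattice time `t` and EVERY start `x` (resp. every strong solution from a deterministic start):
  `|κ_t(Re tr w)(x) − ∫ Re tr w dμ_(β')| ≤ 12√2·π·|w|²·((3(λ+ρ)t + 1)³ + 2)·e^(−ρt)`, `ρ = 1 − 12|β'|`, `λ = (1300 + 4√2)|β'|` —
  e.g. a single plaquette (`|w| = 4`): `≤ 192√2·π·((3(λ+ρ)t+1)³ + 2)·e^(−ρt)`, for every volume.
THEOREMS ONLY, no definition, no sorry; [folklore].  HONEST FRAMING: fixed cut-off and FIXED `|β'| < 1/12` (lattice units); the route's scaling
`β'_K → ∞` leaves the window; nothing `K`-uniform; `UniformColdStartMixing` (24809) is NOT restated; no crux, rung or summit statement is proved; the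
Yang–Mills mass gap is NOT proved.
-/

set_option autoImplicit false

noncomputable section

namespace Summit.QuantumFields.YangMills.Theorems.ColdStartUniversality.LiebRobinson

open MeasureTheory ProbabilityTheory Matrix Complex Finset Filter Set Metric
open scoped ComplexConjugate BigOperators Matrix NNReal ENNReal Topology
open Literature.Probability.Process Literature.MathematicalPhysics.QuantumFieldTheory
open Literature.MathematicalPhysics.QuantumFieldTheory.Balaban1983to89
open Literature.MathematicalPhysics.QuantumLattice (fundamentalRep fundamentalLatticeRep continuous_fundamentalRep fundamentalRep_apply)

variable {L : ℕ} [NeZero L]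

/-! ## §1. The word observable: smoothness, locality, letter count -/

/-- **The real trace of a word of link matrices is smooth** in the real link coordinates (a polynomial). [folklore] -/
theorem contDiff_word (l : List (Edge 3 L × Bool)) {m : WithTop ℕ∞} :
    ContDiff ℝ m (fun y : (Edge 3 L × Fin 2 × Fin 2 × Bool → ℝ) => ((l.map (fun a : Edge 3 L × Bool => if a.2 then ((fun (ee : Edge 3 L) => Matrix.of fun (i j : Fin 2) => ((y (ee, i, j, false) : ℝ) : ℂ) + ((y (ee, i, j, true) : ℝ) : ℂ) * Complex.I) a.1)ᴴ else (fun (ee : Edge 3 L) => Matrix.of fun (i j : Fin 2) => ((y (ee, i, j, false) : ℝ) : ℂ) + ((y (ee, i, j, true) : ℝ) : ℂ) * Complex.I) a.1)).prod).trace.re) := by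
  classical
  set reb : (Edge 3 L × Fin 2 × Fin 2 × Bool → ℝ) → (Edge 3 L → Matrix (Fin 2) (Fin 2) ℂ) := fun z => (fun (ee : Edge 3 L) => Matrix.of fun (i j : Fin 2) => ((z (ee, i, j, false) : ℝ) : ℂ) + ((z (ee, i, j, true) : ℝ) : ℂ) * Complex.I) with hreb
  have hletter : ∀ (a : Edge 3 L × Bool) (i j : Fin 2), ContDiff ℝ m fun y : (Edge 3 L × Fin 2 × Fin 2 × Bool → ℝ) => (fun a : Edge 3 L × Bool => if a.2 then ((reb y) a.1)ᴴ else (reb y) a.1) a i j := by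
    intro a i j
    obtain ⟨e', b⟩ := a
    cases b
    · simp only [Bool.false_eq_true, if_false]
      exact contDiff_entry_rebuild (N := 2) e' i j
    · simp only [if_true]
      exact contDiff_entry_conjTranspose (fun i j => contDiff_entry_rebuild (N := 2) e' i j) i j
  have hwordC : ∀ (l : List (Edge 3 L × Bool)) (i j : Fin 2), ContDiff ℝ m fun y : (Edge 3 L × Fin 2 × Fin 2 × Bool → ℝ) => (l.map (fun a : Edge 3 L × Bool => if a.2 then ((reb y) a.1)ᴴ else (reb y) a.1)).prod i j := by
    intro l
    induction l with
    | nil =>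
        intro i j
        simp only [List.map_nil, List.prod_nil]
        exact contDiff_const
    | cons a l ih =>
        intro i j
        have h : (fun y : (Edge 3 L × Fin 2 × Fin 2 × Bool → ℝ) => ((a :: l).map (fun a : Edge 3 L × Bool => if a.2 then ((reb y) a.1)ᴴ else (reb y) a.1)).prod i j) =
            fun y => ((fun a : Edge 3 L × Bool => if a.2 then ((reb y) a.1)ᴴ else (reb y) a.1) a * (l.map (fun a : Edge 3 L × Bool => if a.2 then ((reb y) a.1)ᴴ else (reb y) a.1)).prod) i j := by
          funext y; rw [List.map_cons, List.prod_cons]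
        rw [h]
        exact contDiff_entry_mul (hletter a) ih i j
  exact contDiff_re_trace (hwordC l)

omit [NeZero L] in
/-- **Locality of a word**: `Re tr w(coords V)` depends only on the links occurring in `w`. [folklore] -/
theorem word_coords_local (l : List (Edge 3 L × Bool)) :
    let coords : GaugeConfig 3 L (Matrix.specialUnitaryGroup (Fin 2) ℂ) → (Edge 3 L × Fin 2 × Fin 2 × Bool → ℝ) :=
      fun V q => (fun z : ℂ => if q.2.2.2 then z.im else z.re)
        ((fundamentalRep (Fin 2) (V q.1) : Matrix (Fin 2) (Fin 2) ℂ) q.2.1 q.2.2.1)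
    ∀ y y' : (GaugeConfig 3 L (Matrix.specialUnitaryGroup (Fin 2) ℂ)), (∀ e ∈ (l.map Prod.fst).toFinset, y e = y' e) →
      (fun y : (Edge 3 L × Fin 2 × Fin 2 × Bool → ℝ) => ((l.map (fun a : Edge 3 L × Bool => if a.2 then ((fun (ee : Edge 3 L) => Matrix.of fun (i j : Fin 2) => ((y (ee, i, j, false) : ℝ) : ℂ) + ((y (ee, i, j, true) : ℝ) : ℂ) * Complex.I) a.1)ᴴ else (fun (ee : Edge 3 L) => Matrix.of fun (i j : Fin 2) => ((y (ee, i, j, false) : ℝ) : ℂ) + ((y (ee, i, j, true) : ℝ) : ℂ) * Complex.I) a.1)).prod).trace.re) (coords y) = (fun y : (Edge 3 L × Fin 2 × Fin 2 × Bool → ℝ) => ((l.map (fun a : Edge 3 L × Bool => if a.2 then ((fun (ee : Edge 3 L) => Matrix.of fun (i j : Fin 2) => ((y (ee, i, j, false) : ℝ) : ℂ) + ((y (ee, i, j, true) : ℝ) : ℂ) * Complex.I) a.1)ᴴ else (fun (ee : Edge 3 L) => Matrix.of fun (i j : Fin 2) => ((y (ee, i, j, false) : ℝ) : ℂ) + ((y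 (ee, i, j, true) : ℝ) : ℂ) * Complex.I) a.1)).prod).trace.re) (coords y') := by
  intro coords y y' hyy'
  classical
  -- the rebuilt matrices are the link matrices
  have hreb : ∀ (V : (GaugeConfig 3 L (Matrix.specialUnitaryGroup (Fin 2) ℂ))) (e : Edge 3 L),
      (Matrix.of fun (i j : Fin 2) => (((coords V) (e, i, j, false) : ℝ) : ℂ) + (((coords V) (e, i, j, true) : ℝ) : ℂ) * Complex.I) =
        matrixConfig (fundamentalRep (Fin 2)) V e :=
    fun V e => (congrFun (rebuild_coords_of V) e).trans (Matrix.ext fun a b => rfl)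
  have hletters : ∀ a ∈ l, (fun a : Edge 3 L × Bool => if a.2 then ((fun (ee : Edge 3 L) => Matrix.of fun (i j : Fin 2) => (((coords y) (ee, i, j, false) : ℝ) : ℂ) + (((coords y) (ee, i, j, true) : ℝ) : ℂ) * Complex.I) a.1)ᴴ else (fun (ee : Edge 3 L) => Matrix.of fun (i j : Fin 2) => (((coords y) (ee, i, j, false) : ℝ) : ℂ) + (((coords y) (ee, i, j, true) : ℝ) : ℂ) * Complex.I) a.1) a =
      (fun a : Edge 3 L × Bool => if a.2 then ((fun (ee : Edge 3 L) => Matrix.of fun (i j : Fin 2) => (((coords y') (ee, i, j, false) : ℝ) : ℂ) + (((coords y') (ee, i, j, true) : ℝ) : ℂ) * Complex.I) a.1)ᴴ else (fun (ee : Edge 3 L) => Matrix.of fun (i j : Fin 2) => (((coords y') (ee, i, j, false) : ℝ) : ℂ) + (((coords y') (ee, i, j, true) : ℝ) : ℂ) * Complex.I) a.1) a := by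
    intro a ha
    have he : y a.1 = y' a.1 := hyy' a.1 (List.mem_toFinset.2 (List.mem_map.2 ⟨a, ha, rfl⟩))
    have hq : matrixConfig (fundamentalRep (Fin 2)) y a.1 = matrixConfig (fundamentalRep (Fin 2)) y' a.1 := by
      show fundamentalRep (Fin 2) (y a.1) = fundamentalRep (Fin 2) (y' a.1)
      rw [he]
    beta_reduce
    rw [hreb y a.1, hreb y' a.1, hq]
  have hmap := List.map_congr_left hletters
  beta_reduce
  rw [hmap]

/-- `Σ_e #{k : edge(a_k) = e} = |w|`: every letter sits on exactly one link. [folklore] -/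
theorem sum_countP_edge_eq_length : ∀ l : List (Edge 3 L × Bool),
    ∑ e : Edge 3 L, ((l.countP fun a => a.1 = e : ℕ) : ℝ) = l.length
  | [] => by simp
  | a :: l => by
      have ih := sum_countP_edge_eq_length l
      have hstep : ∀ e : Edge 3 L, (((a :: l).countP fun a => a.1 = e : ℕ) : ℝ) =
          ((l.countP fun a => a.1 = e : ℕ) : ℝ) + (if a.1 = e then (1 : ℝ) else 0) := by
        intro e
        rw [List.countP_cons]
        push_cast
        by_cases h : a.1 = e
        · simp [h]
        · simp [h]
      simp_rw [hstep]
      rw [Finset.sum_add_distrib, ih, Finset.sum_ite_eq, if_pos (Finset.mem_univ _), List.length_cons]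
      push_cast
      ring

/-! ## §2. The carré du champ of a word: `Γ^A(Re tr w) ≤ 32|w|²` -/

section Calculus

open scoped Matrix.Norms.Operator

/-- ★★ **`Σ_n (W_n Re tr w)² ≤ 32·|w|²` pointwise on `SU(2)^E`** (frame form; `|W_(e,ν) Re tr w| ≤ 2 m_e(w)`, `8` noise directions per link,
`Σ_e m_e(w)² ≤ (Σ_e m_e(w))² = |w|²`). [folklore] -/
theorem wilson_word_carreBound (L : ℕ) [NeZero L] (l : List (Edge 3 L × Bool)) (V : (GaugeConfig 3 L (Matrix.specialUnitaryGroup (Fin 2) ℂ))) :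
    ∑ n : Edge 3 L × NoiseIdx (fundamentalLatticeRep 2).N, (fderiv ℝ (fun y : (Edge 3 L × Fin 2 × Fin 2 × Bool → ℝ) => ((l.map (fun a : Edge 3 L × Bool => if a.2 then ((fun (ee : Edge 3 L) => Matrix.of fun (i j : Fin 2) => ((y (ee, i, j, false) : ℝ) : ℂ) + ((y (ee, i, j, true) : ℝ) : ℂ) * Complex.I) a.1)ᴴ else (fun (ee : Edge 3 L) => Matrix.of fun (i j : Fin 2) => ((y (ee, i, j, false) : ℝ) : ℂ) + ((y (ee, i, j, true) : ℝ) : ℂ) * Complex.I) a.1)).prod).trace.re) ((fun (V : GaugeConfig 3 L (Matrix.specialUnitaryGroup (Fin 2) ℂ)) (q : Edge 3 L × Fin (fundamentalLatticeRep 2).N × Fin (fundamentalLatticeRep 2).N × Bool) => (fun z : ℂ => if q.2.2.2 then z.im else z.re) ((fundamentalRep (Fin 2) (V q.1) : Matrix (Fin 2) (Fin 2) ℂ) q.2.1 q.2.2.1)) V) (fun q : Edge 3 L × Fin (fundamentalLatticeRep 2).N × Fin (fundamentalLatticeRep 2).N × Bool => if n.1 = q.1 then (fun z : ℂ => if q.2.2.2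 then z.im else z.re) (((Real.sqrt 2 : ℂ) • ((fundamentalLatticeRep 2).lieProj (noiseDir n.2) * (fun (ee : Edge 3 L) => Matrix.of fun (i j : Fin (fundamentalLatticeRep 2).N) => (((fun (V : GaugeConfig 3 L (Matrix.specialUnitaryGroup (Fin 2) ℂ)) (q : Edge 3 L × Fin (fundamentalLatticeRep 2).N × Fin (fundamentalLatticeRep 2).N × Bool) => (fun z : ℂ => if q.2.2.2 then z.im else z.re) ((fundamentalRep (Fin 2) (V q.1) : Matrix (Fin 2) (Fin 2) ℂ) q.2.1 q.2.2.1)) V (ee, i, j, false) : ℝ) : ℂ) + (((fun (V : GaugeConfig 3 L (Matrix.specialUnitaryGroup (Fin 2) ℂ)) (q : Edge 3 L × Fin (fundamentalLatticeRep 2).N × Fin (fundamentalLatticeRep 2).N × Bool) => (fun z : ℂ => if q.2.2.2 then z.im else z.re) ((fundamentalRep (Fin 2) (V q.1) : Matrix (Fin 2) (Fin 2) ℂ) q.2.1 q.2.2.1)) V (ee, i, j, true) : ℝ) : ℂ) * Complex.I) q.1)) q.2.1 q.2.2.1) else 0)) ^ 2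
      ≤ 32 * (l.length : ℝ) ^ 2 := by
  classical
  set m : Edge 3 L → ℝ := fun e => ((l.countP fun a => a.1 = e : ℕ) : ℝ) with hm
  have hm0 : ∀ e, 0 ≤ m e := fun e => by rw [hm]; positivity
  have hsum_m : ∑ e, m e = l.length := sum_countP_edge_eq_length l
  have hbound : ∀ n : Edge 3 L × NoiseIdx (fundamentalLatticeRep 2).N, (fderiv ℝ (fun y : (Edge 3 L × Fin 2 × Fin 2 × Bool → ℝ) => ((l.map (fun a : Edge 3 L × Bool => if a.2 then ((fun (ee : Edge 3 L) => Matrix.of fun (i j : Fin 2) => ((y (ee, i, j, false) : ℝ) : ℂ) + ((y (ee, i, j, true) : ℝ) : ℂ) * Complex.I) a.1)ᴴ else (fun (ee : Edge 3 L) => Matrix.of fun (i j : Fin 2) => ((y (ee, i, j, false) : ℝ) : ℂ) + ((y (ee, i, j, true) : ℝ) : ℂ) * Complex.I) a.1)).prod).trace.re) ((fun (V : GaugeConfig 3 L (Matrix.specialUnitaryGroup (Fin 2) ℂ)) (q : Edge 3 L × Fin (fundamentalLatticeRep 2).N × Fin (fundamentalLatticeRep 2).N × Bool) => (fun z : ℂ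 => if q.2.2.2 then z.im else z.re) ((fundamentalRep (Fin 2) (V q.1) : Matrix (Fin 2) (Fin 2) ℂ) q.2.1 q.2.2.1)) V) (fun q : Edge 3 L × Fin (fundamentalLatticeRep 2).N × Fin (fundamentalLatticeRep 2).N × Bool => if n.1 = q.1 then (fun z : ℂ => if q.2.2.2 then z.im else z.re) (((Real.sqrt 2 : ℂ) • ((fundamentalLatticeRep 2).lieProj (noiseDir n.2) * (fun (ee : Edge 3 L) => Matrix.of fun (i j : Fin (fundamentalLatticeRep 2).N) => (((fun (V : GaugeConfig 3 L (Matrix.specialUnitaryGroup (Fin 2) ℂ)) (q : Edge 3 L × Fin (fundamentalLatticeRep 2).N × Fin (fundamentalLatticeRep 2).N × Bool) => (fun z : ℂ => if q.2.2.2 then z.im else z.re) ((fundamentalRep (Fin 2) (V q.1) : Matrix (Fin 2) (Fin 2) ℂ) q.2.1 q.2.2.1)) V (ee, i, j, false) : ℝ) : ℂ) + (((fun (V : GaugeConfig 3 L (Matrix.specialUnitaryGroup (Fin 2) ℂ)) (q : Edge 3 L × Fin (fundamentalLatticeRep 2).N × Fin (fundamentalLatticeRep 2).N × Bool) => (fun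 z : ℂ => if q.2.2.2 then z.im else z.re) ((fundamentalRep (Fin 2) (V q.1) : Matrix (Fin 2) (Fin 2) ℂ) q.2.1 q.2.2.1)) V (ee, i, j, true) : ℝ) : ℂ) * Complex.I) q.1)) q.2.1 q.2.2.1) else 0)) ^ 2 ≤ 4 * m n.1 ^ 2 := by
    intro n
    have h' : |fderiv ℝ (fun y : (Edge 3 L × Fin 2 × Fin 2 × Bool → ℝ) => ((l.map (fun a : Edge 3 L × Bool => if a.2 then ((fun (ee : Edge 3 L) => Matrix.of fun (i j : Fin 2) => ((y (ee, i, j, false) : ℝ) : ℂ) + ((y (ee, i, j, true) : ℝ) : ℂ) * Complex.I) a.1)ᴴ else (fun (ee : Edge 3 L) => Matrix.of fun (i j : Fin 2) => ((y (ee, i, j, false) : ℝ) : ℂ) + ((y (ee, i, j, true) : ℝ) : ℂ) * Complex.I) a.1)).prod).trace.re) ((fun (V : GaugeConfig 3 L (Matrix.specialUnitaryGroup (Fin 2) ℂ)) (q : Edge 3 L × Fin (fundamentalLatticeRep 2).N × Fin (fundamentalLatticeRep 2).N × Bool) => (fun z : ℂ => if q.2.2.2 then z.im else z.re) ((fundamentalRep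 (Fin 2) (V q.1) : Matrix (Fin 2) (Fin 2) ℂ) q.2.1 q.2.2.1)) V) (fun q : Edge 3 L × Fin (fundamentalLatticeRep 2).N × Fin (fundamentalLatticeRep 2).N × Bool => if n.1 = q.1 then (fun z : ℂ => if q.2.2.2 then z.im else z.re) (((Real.sqrt 2 : ℂ) • ((fundamentalLatticeRep 2).lieProj (noiseDir n.2) * (fun (ee : Edge 3 L) => Matrix.of fun (i j : Fin (fundamentalLatticeRep 2).N) => (((fun (V : GaugeConfig 3 L (Matrix.specialUnitaryGroup (Fin 2) ℂ)) (q : Edge 3 L × Fin (fundamentalLatticeRep 2).N × Fin (fundamentalLatticeRep 2).N × Bool) => (fun z : ℂ => if q.2.2.2 then z.im else z.re) ((fundamentalRep (Fin 2) (V q.1) : Matrix (Fin 2) (Fin 2) ℂ) q.2.1 q.2.2.1)) V (ee, i, j, false) : ℝ) : ℂ) + (((fun (V : GaugeConfig 3 L (Matrix.specialUnitaryGroup (Fin 2) ℂ)) (q : Edge 3 L × Fin (fundamentalLatticeRep 2).N × Fin (fundamentalLatticeRep 2).N × Bool) => (fun z : ℂ => if q.2.2.2 then z.im else z.re) ((fundamentalRep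 (Fin 2) (V q.1) : Matrix (Fin 2) (Fin 2) ℂ) q.2.1 q.2.2.1)) V (ee, i, j, true) : ℝ) : ℂ) * Complex.I) q.1)) q.2.1 q.2.2.1) else 0)| ≤ 2 * m n.1 := word_frameDeriv_abs_le V n l
    have h0 : 0 ≤ 2 * m n.1 := by positivity
    have h2 := (abs_le.1 h')
    nlinarith [h2.1, h2.2]
  have hcard8 : Fintype.card (NoiseIdx (fundamentalLatticeRep 2).N) = 8 := by
    rw [Literature.MathematicalPhysics.QuantumLattice.fundamentalLatticeRep_N]; rfl
  have hsq : ∑ e, m e ^ 2 ≤ (∑ e, m e) ^ 2 := by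
    rw [sq (∑ e, m e), Finset.sum_mul]
    refine Finset.sum_le_sum fun e _ => ?_
    rw [sq]
    exact mul_le_mul_of_nonneg_left (Finset.single_le_sum (f := m) (fun f _ => hm0 f) (Finset.mem_univ e)) (hm0 e)
  calc ∑ n : Edge 3 L × NoiseIdx (fundamentalLatticeRep 2).N, (fderiv ℝ (fun y : (Edge 3 L × Fin 2 × Fin 2 × Bool → ℝ) => ((l.map (fun a : Edge 3 L × Bool => if a.2 then ((fun (ee : Edge 3 L) => Matrix.of fun (i j : Fin 2) => ((y (ee, i, j, false) : ℝ) : ℂ) + ((y (ee, i, j, true) : ℝ) : ℂ) * Complex.I) a.1)ᴴ else (fun (ee : Edge 3 L) => Matrix.of fun (i j : Fin 2) => ((y (ee, i, j, false) : ℝ) : ℂ) + ((y (ee, i, j, true) : ℝ) : ℂ) * Complex.I) a.1)).prod).trace.re) ((fun (V : GaugeConfig 3 L (Matrix.specialUnitaryGroup (Fin 2) ℂ)) (q : Edge 3 L × Fin (fundamentalLatticeRep 2).N × Fin (fundamentalLatticeRep 2).N × Bool) => (fun z : ℂ => if q.2.2.2 then z.im else z.re) ((fundamentalRep (Fin 2)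 (V q.1) : Matrix (Fin 2) (Fin 2) ℂ) q.2.1 q.2.2.1)) V) (fun q : Edge 3 L × Fin (fundamentalLatticeRep 2).N × Fin (fundamentalLatticeRep 2).N × Bool => if n.1 = q.1 then (fun z : ℂ => if q.2.2.2 then z.im else z.re) (((Real.sqrt 2 : ℂ) • ((fundamentalLatticeRep 2).lieProj (noiseDir n.2) * (fun (ee : Edge 3 L) => Matrix.of fun (i j : Fin (fundamentalLatticeRep 2).N) => (((fun (V : GaugeConfig 3 L (Matrix.specialUnitaryGroup (Fin 2) ℂ)) (q : Edge 3 L × Fin (fundamentalLatticeRep 2).N × Fin (fundamentalLatticeRep 2).N × Bool) => (fun z : ℂ => if q.2.2.2 then z.im else z.re) ((fundamentalRep (Fin 2) (V q.1) : Matrix (Fin 2) (Fin 2) ℂ) q.2.1 q.2.2.1)) V (ee, i, j, false) : ℝ) : ℂ) + (((fun (V : GaugeConfig 3 L (Matrix.specialUnitaryGroup (Fin 2) ℂ)) (q : Edge 3 L × Fin (fundamentalLatticeRep 2).N × Fin (fundamentalLatticeRep 2).N × Bool) => (fun z : ℂ => if q.2.2.2 then z.im else z.re) ((fundamentalRep (Fin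 2) (V q.1) : Matrix (Fin 2) (Fin 2) ℂ) q.2.1 q.2.2.1)) V (ee, i, j, true) : ℝ) : ℂ) * Complex.I) q.1)) q.2.1 q.2.2.1) else 0)) ^ 2
      ≤ ∑ n : Edge 3 L × NoiseIdx (fundamentalLatticeRep 2).N, 4 * m n.1 ^ 2 := Finset.sum_le_sum fun n _ => hbound n
    _ = ∑ e : Edge 3 L, ∑ _ν : NoiseIdx (fundamentalLatticeRep 2).N, 4 * m e ^ 2 := by rw [Fintype.sum_prod_type]
    _ = ∑ e : Edge 3 L, 8 * (4 * m e ^ 2) := by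
        refine Finset.sum_congr rfl fun e _ => ?_
        rw [Finset.sum_const, Finset.card_univ, hcard8, nsmul_eq_mul]
        push_cast; ring
    _ = 8 * (4 * ∑ e : Edge 3 L, m e ^ 2) := by rw [Finset.mul_sum, Finset.mul_sum]
    _ ≤ 8 * (4 * (∑ e, m e) ^ 2) := by gcongr
    _ = 32 * (l.length : ℝ) ^ 2 := by rw [hsum_m]; ring

end Calculus

/-- ★★ **`Γ^A(Re tr w) ≤ 32·|w|²` in coordinate form** (the hypothesis shape of `wilson_local_pointwise_mixing_uniform`). [folklore] -/
theorem wilson_word_carre_le (L : ℕ) [NeZero L] (β' : ℝ) (l : List (Edge 3 L × Bool)) :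
    let coords : GaugeConfig 3 L (Matrix.specialUnitaryGroup (Fin 2) ℂ) → (Edge 3 L × Fin 2 × Fin 2 × Bool → ℝ) :=
      fun V q => (fun z : ℂ => if q.2.2.2 then z.im else z.re)
        ((fundamentalRep (Fin 2) (V q.1) : Matrix (Fin 2) (Fin 2) ℂ) q.2.1 q.2.2.1)
    let A : GaugeConfig 3 L (Matrix.specialUnitaryGroup (Fin 2) ℂ) → (Edge 3 L × Fin 2 × Fin 2 × Bool) →
        (Edge 3 L × Fin 2 × Fin 2 × Bool) → ℝ := fun V i j =>
      ∑ n : Edge 3 L × NoiseIdx 2,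
        (if n.1 = i.1 then (fun z : ℂ => if i.2.2.2 then z.im else z.re)
          ((latticeLangevinDynamics (fundamentalLatticeRep 2) β').noise
            (matrixConfig (fundamentalRep (Fin 2)) V) i.1 n.2 i.2.1 i.2.2.1) else 0) *
        (if n.1 = j.1 then (fun z : ℂ => if j.2.2.2 then z.im else z.re)
          ((latticeLangevinDynamics (fundamentalLatticeRep 2) β').noise
            (matrixConfig (fundamentalRep (Fin 2)) V) j.1 n.2 j.2.1 j.2.2.1) else 0)
    ∀ V : (GaugeConfig 3 L (Matrix.specialUnitaryGroup (Fin 2) ℂ)), (∑ i : Edge 3 L × Fin 2 × Fin 2 × Bool, ∑ j : Edge 3 L × Fin 2 × Fin 2 × Bool,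
      fderiv ℝ (fun y : (Edge 3 L × Fin 2 × Fin 2 × Bool → ℝ) => ((l.map (fun a : Edge 3 L × Bool => if a.2 then ((fun (ee : Edge 3 L) => Matrix.of fun (i j : Fin 2) => ((y (ee, i, j, false) : ℝ) : ℂ) + ((y (ee, i, j, true) : ℝ) : ℂ) * Complex.I) a.1)ᴴ else (fun (ee : Edge 3 L) => Matrix.of fun (i j : Fin 2) => ((y (ee, i, j, false) : ℝ) : ℂ) + ((y (ee, i, j, true) : ℝ) : ℂ) * Complex.I) a.1)).prod).trace.re) (coords V) (Pi.single i 1) * fderiv ℝ (fun y : (Edge 3 L × Fin 2 × Fin 2 × Bool → ℝ) => ((l.map (fun a : Edge 3 L × Bool => if a.2 then ((fun (ee : Edge 3 L) => Matrix.of fun (i j : Fin 2) => ((y (ee, i, j, false) : ℝ) : ℂ) + ((y (ee, i, j, true) : ℝ) : ℂ) * Complex.I) a.1)ᴴ else (fun (ee : Edge 3 L) => Matrix.of fun (i j : Fin 2) => ((y (ee, i, j, false) : ℝ) : ℂ) + ((y (ee, i, j, true) : ℝ) : ℂ) * Complex.I) a.1)).prod).trace.re) (coords V) (Pi.single j 1)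 * A V i j) ≤ 32 * (l.length : ℝ) ^ 2 := by
  intro coords A V
  classical
  have hframe : (∑ i : Edge 3 L × Fin 2 × Fin 2 × Bool, ∑ j : Edge 3 L × Fin 2 × Fin 2 × Bool,
      fderiv ℝ (fun y : (Edge 3 L × Fin 2 × Fin 2 × Bool → ℝ) => ((l.map (fun a : Edge 3 L × Bool => if a.2 then ((fun (ee : Edge 3 L) => Matrix.of fun (i j : Fin 2) => ((y (ee, i, j, false) : ℝ) : ℂ) + ((y (ee, i, j, true) : ℝ) : ℂ) * Complex.I) a.1)ᴴ else (fun (ee : Edge 3 L) => Matrix.of fun (i j : Fin 2) => ((y (ee, i, j, false) : ℝ) : ℂ) + ((y (ee, i, j, true) : ℝ) : ℂ) * Complex.I) a.1)).prod).trace.re) (coords V) (Pi.single i 1) * fderiv ℝ (fun y : (Edge 3 L × Fin 2 × Fin 2 × Bool → ℝ) => ((l.map (fun a : Edge 3 L × Bool => if a.2 then ((fun (ee : Edge 3 L) => Matrix.of fun (i j : Fin 2) => ((y (ee, i, j, false) : ℝ) : ℂ) + ((y (ee, i, j, true) : ℝ) : ℂ) * Complex.I) a.1)ᴴ else (fun (ee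 : Edge 3 L) => Matrix.of fun (i j : Fin 2) => ((y (ee, i, j, false) : ℝ) : ℂ) + ((y (ee, i, j, true) : ℝ) : ℂ) * Complex.I) a.1)).prod).trace.re) (coords V) (Pi.single j 1) * A V i j) =
      ∑ n : Edge 3 L × NoiseIdx (fundamentalLatticeRep 2).N, fderiv ℝ (fun y : (Edge 3 L × Fin 2 × Fin 2 × Bool → ℝ) => ((l.map (fun a : Edge 3 L × Bool => if a.2 then ((fun (ee : Edge 3 L) => Matrix.of fun (i j : Fin 2) => ((y (ee, i, j, false) : ℝ) : ℂ) + ((y (ee, i, j, true) : ℝ) : ℂ) * Complex.I) a.1)ᴴ else (fun (ee : Edge 3 L) => Matrix.of fun (i j : Fin 2) => ((y (ee, i, j, false) : ℝ) : ℂ) + ((y (ee, i, j, true) : ℝ) : ℂ) * Complex.I) a.1)).prod).trace.re) (coords V) (fun q : Edge 3 L × Fin (fundamentalLatticeRep 2).N × Fin (fundamentalLatticeRep 2).N × Bool => if n.1 = q.1 then (fun z : ℂ => if q.2.2.2 then z.im else z.re) (((Real.sqrt 2 : ℂ) • ((fundamentalLatticeRep 2).lieProj (noiseDir n.2) * (fun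 (ee : Edge 3 L) => Matrix.of fun (i j : Fin (fundamentalLatticeRep 2).N) => (((coords V) (ee, i, j, false) : ℝ) : ℂ) + (((coords V) (ee, i, j, true) : ℝ) : ℂ) * Complex.I) q.1)) q.2.1 q.2.2.1) else 0) * fderiv ℝ (fun y : (Edge 3 L × Fin 2 × Fin 2 × Bool → ℝ) => ((l.map (fun a : Edge 3 L × Bool => if a.2 then ((fun (ee : Edge 3 L) => Matrix.of fun (i j : Fin 2) => ((y (ee, i, j, false) : ℝ) : ℂ) + ((y (ee, i, j, true) : ℝ) : ℂ) * Complex.I) a.1)ᴴ else (fun (ee : Edge 3 L) => Matrix.of fun (i j : Fin 2) => ((y (ee, i, j, false) : ℝ) : ℂ) + ((y (ee, i, j, true) : ℝ) : ℂ) * Complex.I) a.1)).prod).trace.re) (coords V) (fun q : Edge 3 L × Fin (fundamentalLatticeRep 2).N × Fin (fundamentalLatticeRep 2).N × Bool => if n.1 = q.1 then (fun z : ℂ => if q.2.2.2 then z.im else z.re) (((Real.sqrt 2 : ℂ) • ((fundamentalLatticeRep 2).lieProj (noiseDir n.2) * (fun (ee : Edge 3 L) => Matrix.of fun (i j : Fin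 (fundamentalLatticeRep 2).N) => (((coords V) (ee, i, j, false) : ℝ) : ℂ) + (((coords V) (ee, i, j, true) : ℝ) : ℂ) * Complex.I) q.1)) q.2.1 q.2.2.1) else 0) :=
    carre_eq_sum_frameDeriv_mul L β' (fun y : (Edge 3 L × Fin 2 × Fin 2 × Bool → ℝ) => ((l.map (fun a : Edge 3 L × Bool => if a.2 then ((fun (ee : Edge 3 L) => Matrix.of fun (i j : Fin 2) => ((y (ee, i, j, false) : ℝ) : ℂ) + ((y (ee, i, j, true) : ℝ) : ℂ) * Complex.I) a.1)ᴴ else (fun (ee : Edge 3 L) => Matrix.of fun (i j : Fin 2) => ((y (ee, i, j, false) : ℝ) : ℂ) + ((y (ee, i, j, true) : ℝ) : ℂ) * Complex.I) a.1)).prod).trace.re) (fun y : (Edge 3 L × Fin 2 × Fin 2 × Bool → ℝ) => ((l.map (fun a : Edge 3 L × Bool => if a.2 then ((fun (ee : Edge 3 L) => Matrix.of fun (i j : Fin 2) => ((y (ee, i, j, false) : ℝ) : ℂ) + ((y (ee, i, j, true) : ℝ) : ℂ) * Complex.I) a.1)ᴴ else (fun (ee : Edge 3 L) => Matrix.of fun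 (i j : Fin 2) => ((y (ee, i, j, false) : ℝ) : ℂ) + ((y (ee, i, j, true) : ℝ) : ℂ) * Complex.I) a.1)).prod).trace.re) V
  rw [hframe]
  have hb : ∑ n : Edge 3 L × NoiseIdx (fundamentalLatticeRep 2).N, (fderiv ℝ (fun y : (Edge 3 L × Fin 2 × Fin 2 × Bool → ℝ) => ((l.map (fun a : Edge 3 L × Bool => if a.2 then ((fun (ee : Edge 3 L) => Matrix.of fun (i j : Fin 2) => ((y (ee, i, j, false) : ℝ) : ℂ) + ((y (ee, i, j, true) : ℝ) : ℂ) * Complex.I) a.1)ᴴ else (fun (ee : Edge 3 L) => Matrix.of fun (i j : Fin 2) => ((y (ee, i, j, false) : ℝ) : ℂ) + ((y (ee, i, j, true) : ℝ) : ℂ) * Complex.I) a.1)).prod).trace.re) (coords V) (fun q : Edge 3 L × Fin (fundamentalLatticeRep 2).N × Fin (fundamentalLatticeRep 2).N × Bool => if n.1 = q.1 then (fun z : ℂ => if q.2.2.2 then z.im else z.re) (((Real.sqrt 2 : ℂ) • ((fundamentalLatticeRep 2).lieProj (noiseDir n.2) * (fun (ee : Edge 3 L) => Matrix.of fun (i j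 : Fin (fundamentalLatticeRep 2).N) => (((coords V) (ee, i, j, false) : ℝ) : ℂ) + (((coords V) (ee, i, j, true) : ℝ) : ℂ) * Complex.I) q.1)) q.2.1 q.2.2.1) else 0)) ^ 2 ≤ 32 * (l.length : ℝ) ^ 2 :=
    wilson_word_carreBound L l V
  refine le_of_eq_of_le ?_ hb
  exact Finset.sum_congr rfl fun n _ => by rw [sq]

/-! ## §3. Every-start mixing of a fixed Wilson loop word, volume-free -/

/-- ★★★ **A FIXED WILSON LOOP WORD EQUILIBRATES FROM EVERY START, VOLUME-FREE.**  At `|β'| < 1/12`, for every torus size `L`, every Markov kernel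
family `κ` realising the transition laws of the `SU(2)` SZZ dynamics, every word `w` of link matrices / adjoints, every `t` and EVERY start `x`:
`|κ_t(Re tr w)(x) − ∫ Re tr w dμ_(β')| ≤ 12√2·π·|w|²·((3(λ+ρ)t + 1)³ + 2)·e^(−ρt)`, `ρ = 1 − 12|β'|`, `λ = (1300+4√2)|β'|`. [folklore] -/
theorem wilson_word_pointwise_mixing_uniform (L : ℕ) [NeZero L] (β' : ℝ) (hβ : |β'| < 1 / 12)
    (κ : ℝ≥0 → Kernel (GaugeConfig 3 L (Matrix.specialUnitaryGroup (Fin 2) ℂ))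
      (GaugeConfig 3 L (Matrix.specialUnitaryGroup (Fin 2) ℂ))) [∀ t, IsMarkovKernel (κ t)]
    (hreal : ∀ (t : ℝ≥0) (x : GaugeConfig 3 L (Matrix.specialUnitaryGroup (Fin 2) ℂ))
        (Ω : Type) [MeasurableSpace Ω] (P : Measure Ω) [IsProbabilityMeasure P]
        (W : ℝ≥0 → Ω → (Edge 3 L × NoiseIdx 2 → ℝ)) (hW : IsFlatBrownian W P)
        (U : ℝ≥0 → Ω → GaugeConfig 3 L (Matrix.specialUnitaryGroup (Fin 2) ℂ)),
        (∀ ω, U 0 ω = x) →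
        (latticeLangevinDynamics (fundamentalLatticeRep 2) β').IsSolution (fundamentalRep (Fin 2))
          hW.natFiltration P W U →
        κ t x = P.map (U t))
    (l : List (Edge 3 L × Bool)) (t : ℝ≥0) (x : (GaugeConfig 3 L (Matrix.specialUnitaryGroup (Fin 2) ℂ))) :
    let coords : GaugeConfig 3 L (Matrix.specialUnitaryGroup (Fin 2) ℂ) → (Edge 3 L × Fin 2 × Fin 2 × Bool → ℝ) :=
      fun V q => (fun z : ℂ => if q.2.2.2 then z.im else z.re)
        ((fundamentalRep (Fin 2) (V q.1) : Matrix (Fin 2) (Fin 2) ℂ) q.2.1 q.2.2.1)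
    |∫ y, (fun y : (Edge 3 L × Fin 2 × Fin 2 × Bool → ℝ) => ((l.map (fun a : Edge 3 L × Bool => if a.2 then ((fun (ee : Edge 3 L) => Matrix.of fun (i j : Fin 2) => ((y (ee, i, j, false) : ℝ) : ℂ) + ((y (ee, i, j, true) : ℝ) : ℂ) * Complex.I) a.1)ᴴ else (fun (ee : Edge 3 L) => Matrix.of fun (i j : Fin 2) => ((y (ee, i, j, false) : ℝ) : ℂ) + ((y (ee, i, j, true) : ℝ) : ℂ) * Complex.I) a.1)).prod).trace.re) (coords y) ∂(κ t x) - ∫ y, (fun y : (Edge 3 L × Fin 2 × Fin 2 × Bool → ℝ) => ((l.map (fun a : Edge 3 L × Bool => if a.2 then ((fun (ee : Edge 3 L) => Matrix.of fun (i j : Fin 2) => ((y (ee, i, j, false) : ℝ) : ℂ) + ((y (ee, i, j, true) : ℝ) : ℂ) * Complex.I) a.1)ᴴ else (fun (ee : Edge 3 L) => Matrix.of fun (i j : Fin 2) => ((y (ee, i, j, false) : ℝ) : ℂ) + ((y (ee, i, j, true) : ℝ) : ℂ) * Complex.I) a.1)).prod).trace.re) (coords y) ∂(wilsonMeasure (d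 := 3) (L := L) (fundamentalRep (Fin 2)) β')| ≤
      12 * Real.sqrt 2 * Real.pi * (l.length : ℝ) ^ 2 * ((3 * (((1300 + 4 * Real.sqrt 2) * |β'| + (1 - 12 * |β'|)) * (t : ℝ)) + 1) ^ 3 + 2) * Real.exp (-((1 - 12 * |β'|) * (t : ℝ))) := by
  intro coords
  classical
  have hσ : 0 ≤ 4 * Real.sqrt 2 * (l.length : ℝ) := by positivity
  have hsq : (4 * Real.sqrt 2 * (l.length : ℝ)) ^ 2 = 32 * (l.length : ℝ) ^ 2 := by
    rw [mul_pow, mul_pow, Real.sq_sqrt (by norm_num : (0:ℝ) ≤ 2)]; ring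
  have hΓ := wilson_word_carre_le L β' l
  have h := wilson_local_pointwise_mixing_uniform L β' hβ κ hreal (contDiff_word l) hσ (l.map Prod.fst).toFinset t
    (fun y => by rw [hsq]; exact hΓ y) (word_coords_local l) x
  have hcard : (((l.map Prod.fst).toFinset.card : ℕ) : ℝ) ≤ l.length := by
    have h1 := List.toFinset_card_le (l.map Prod.fst)
    rw [List.length_map] at h1
    exact_mod_cast h1
  have hlin : 0 ≤ ((1300 + 4 * Real.sqrt 2) * |β'| + (1 - 12 * |β'|)) * (t : ℝ) :=
    mul_nonneg (by nlinarith [abs_nonneg β', Real.sqrt_nonneg 2, hβ]) t.2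
  have hcube : 0 ≤ (3 * (((1300 + 4 * Real.sqrt 2) * |β'| + (1 - 12 * |β'|)) * (t : ℝ)) + 1) ^ 3 := pow_nonneg (by linarith) 3
  calc _ ≤ 3 * Real.pi * ((l.map Prod.fst).toFinset.card : ℝ) * (4 * Real.sqrt 2 * (l.length : ℝ)) * ((3 * (((1300 + 4 * Real.sqrt 2) * |β'| + (1 - 12 * |β'|)) * (t : ℝ)) + 1) ^ 3 + 2) * Real.exp (-((1 - 12 * |β'|) * (t : ℝ))) := h
    _ ≤ 3 * Real.pi * (l.length : ℝ) * (4 * Real.sqrt 2 * (l.length : ℝ)) * ((3 * (((1300 + 4 * Real.sqrt 2) * |β'| + (1 - 12 * |β'|)) * (t : ℝ)) + 1) ^ 3 + 2) * Real.exp (-((1 - 12 * |β'|) * (t : ℝ))) :=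
        mul_le_mul_of_nonneg_right (mul_le_mul_of_nonneg_right
          (mul_le_mul_of_nonneg_right (mul_le_mul_of_nonneg_left hcard (by positivity)) hσ) (by linarith)) (Real.exp_pos _).le
    _ = 12 * Real.sqrt 2 * Real.pi * (l.length : ℝ) ^ 2 * ((3 * (((1300 + 4 * Real.sqrt 2) * |β'| + (1 - 12 * |β'|)) * (t : ℝ)) + 1) ^ 3 + 2) * Real.exp (-((1 - 12 * |β'|) * (t : ℝ))) := by ring

/-- ★★★ **Along every SZZ solution from a deterministic start** (e.g. the cold start), for every word `w`, every `t`, every volume `L`: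
`|E[Re tr w(U_t)] − ∫ Re tr w dμ_(β')| ≤ 12√2·π·|w|²·((3(λ+ρ)t + 1)³ + 2)·e^(−ρt)` at `|β'| < 1/12`.  For a single plaquette (`|w| = 4`) the
constant is `192√2·π`; for an `R × T` Wilson loop `12√2·π·(2R+2T)²` — independent of `L` and of the position of the loop. [folklore] -/
theorem wilson_solution_word_pointwise_mixing_uniform (L : ℕ) [NeZero L] (β' : ℝ) (hβ : |β'| < 1 / 12) (t : ℝ≥0)
    (x₀ : (GaugeConfig 3 L (Matrix.specialUnitaryGroup (Fin 2) ℂ))) (Ω : Type) [MeasurableSpace Ω] (P : Measure Ω) [IsProbabilityMeasure P]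
    (W : ℝ≥0 → Ω → (Edge 3 L × NoiseIdx 2 → ℝ)) (hW : IsFlatBrownian W P)
    (U : ℝ≥0 → Ω → (GaugeConfig 3 L (Matrix.specialUnitaryGroup (Fin 2) ℂ))) (hU0 : ∀ ω, U 0 ω = x₀)
    (hU : (latticeLangevinDynamics (fundamentalLatticeRep 2) β').IsSolution (fundamentalRep (Fin 2)) hW.natFiltration P W U)
    (l : List (Edge 3 L × Bool)) :
    let coords : GaugeConfig 3 L (Matrix.specialUnitaryGroup (Fin 2) ℂ) → (Edge 3 L × Fin 2 × Fin 2 × Bool → ℝ) :=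
      fun V q => (fun z : ℂ => if q.2.2.2 then z.im else z.re)
        ((fundamentalRep (Fin 2) (V q.1) : Matrix (Fin 2) (Fin 2) ℂ) q.2.1 q.2.2.1)
    |∫ ω, (fun y : (Edge 3 L × Fin 2 × Fin 2 × Bool → ℝ) => ((l.map (fun a : Edge 3 L × Bool => if a.2 then ((fun (ee : Edge 3 L) => Matrix.of fun (i j : Fin 2) => ((y (ee, i, j, false) : ℝ) : ℂ) + ((y (ee, i, j, true) : ℝ) : ℂ) * Complex.I) a.1)ᴴ else (fun (ee : Edge 3 L) => Matrix.of fun (i j : Fin 2) => ((y (ee, i, j, false) : ℝ) : ℂ) + ((y (ee, i, j, true) : ℝ) : ℂ) * Complex.I) a.1)).prod).trace.re) (coords (U t ω)) ∂P - ∫ y, (fun y : (Edge 3 L × Fin 2 × Fin 2 × Bool → ℝ) => ((l.map (fun a : Edge 3 L × Bool => if a.2 then ((fun (ee : Edge 3 L) => Matrix.of fun (i j : Fin 2) => ((y (ee, i, j, false) : ℝ) : ℂ) + ((y (ee, i, j, true) : ℝ) : ℂ) * Complex.I) a.1)ᴴ else (fun (ee : Edge 3 L) => Matrix.of fun (i j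 : Fin 2) => ((y (ee, i, j, false) : ℝ) : ℂ) + ((y (ee, i, j, true) : ℝ) : ℂ) * Complex.I) a.1)).prod).trace.re) (coords y) ∂(wilsonMeasure (d := 3) (L := L) (fundamentalRep (Fin 2)) β')| ≤
      12 * Real.sqrt 2 * Real.pi * (l.length : ℝ) ^ 2 * ((3 * (((1300 + 4 * Real.sqrt 2) * |β'| + (1 - 12 * |β'|)) * (t : ℝ)) + 1) ^ 3 + 2) * Real.exp (-((1 - 12 * |β'|) * (t : ℝ))) := by
  intro coords
  classical
  haveI := secondCountableTopology_su2
  haveI := borelSpace_config L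
  obtain ⟨κ, hκ, -, hreal⟩ := exists_transitionKernel L β'
  haveI := hκ
  have h := wilson_word_pointwise_mixing_uniform L β' hβ κ hreal l t x₀
  have hlaw : κ t x₀ = P.map (U t) := hreal t x₀ Ω P W hW U hU0 hU
  have hmU : Measurable (U t) := (hU.adapted t).mono (hW.natFiltration.le t) le_rfl
  have hFm : Measurable fun y : (GaugeConfig 3 L (Matrix.specialUnitaryGroup (Fin 2) ℂ)) => (fun y : (Edge 3 L × Fin 2 × Fin 2 × Bool → ℝ) => ((l.map (fun a : Edge 3 L × Bool => if a.2 then ((fun (ee : Edge 3 L) => Matrix.of fun (i j : Fin 2) => ((y (ee, i, j, false) : ℝ) : ℂ) + ((y (ee, i, j, true) : ℝ) : ℂ) * Complex.I) a.1)ᴴ else (fun (ee : Edge 3 L) => Matrix.of fun (i j : Fin 2) => ((y (ee, i, j, false) : ℝ) : ℂ) + ((y (ee, i, j, true) : ℝ) : ℂ) * Complex.I) a.1)).prod).trace.re) (coords y) :=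
    ((contDiff_word (L := L) l (m := 1)).continuous.comp (continuous_coords (L := L))).measurable
  have e1 : ∫ y, (fun y : (Edge 3 L × Fin 2 × Fin 2 × Bool → ℝ) => ((l.map (fun a : Edge 3 L × Bool => if a.2 then ((fun (ee : Edge 3 L) => Matrix.of fun (i j : Fin 2) => ((y (ee, i, j, false) : ℝ) : ℂ) + ((y (ee, i, j, true) : ℝ) : ℂ) * Complex.I) a.1)ᴴ else (fun (ee : Edge 3 L) => Matrix.of fun (i j : Fin 2) => ((y (ee, i, j, false) : ℝ) : ℂ) + ((y (ee, i, j, true) : ℝ) : ℂ) * Complex.I) a.1)).prod).trace.re) (coords y) ∂(κ t x₀) = ∫ ω, (fun y : (Edge 3 L × Fin 2 × Fin 2 × Bool → ℝ) => ((l.map (fun a : Edge 3 L × Bool => if a.2 then ((fun (ee : Edge 3 L) => Matrix.of fun (i j : Fin 2) => ((y (ee, i, j, false) : ℝ) : ℂ) + ((y (ee, i, j, true) : ℝ) : ℂ) * Complex.I) a.1)ᴴ else (fun (ee : Edge 3 L) => Matrix.of fun (i j : Fin 2) => ((y (ee, i, j, false) : ℝ) : ℂ) + ((y (ee, i, j,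 true) : ℝ) : ℂ) * Complex.I) a.1)).prod).trace.re) (coords (U t ω)) ∂P := by
    rw [hlaw, integral_map hmU.aemeasurable hFm.aestronglyMeasurable]
  rw [← e1]
  exact h

end Summit.QuantumFields.YangMills.Theorems.ColdStartUniversality.LiebRobinson
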